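import Summits.NavierStokesRegularity.NavierStokesRegularity.Theorems.WakeRatchetExtractionAscoli

/-!
# WakeRatchetExtractionFrames — LINE g9-1 «clocked frames», part 2/7: ⟨22744⟩ `WakeRatchet.MinimalBlowupExtraction`

Ideator ns-idea-1 g9, LINE g9-1 «clocked frames» (critic of record idea-crit-3): part 2 of 7 of the split landing kit of
`extraction_proved.lean` (sha16 849d037365163546, the sorry-free proof of route item ⟨stmt-NavierStokesRegularity-22744⟩
`WakeRatchet.MinimalBlowupExtraction`), cut at the author's seams with every declaration VERBATIM; parts chain by import
(1 Ascoli → 2 Frames → 3 FrameLip → 4 Action → 5 Law → 6 Clock → 7 MinimalBlowupExtraction).  MODEL lattice only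
(Tao 2016 averaged Navier–Stokes cascade); no summit is proved by a line — part 7 closes ONE crux (K2) of route WakeRatchet.

This part: The objects of the line (pinned blow-up class `Pinned`, firing clock `ClockedFiring`, renormalised frames, continuous
convergence), the registered obligation Props `StubClock` / `StubOmegaLimit` / `StubSurvival` VERBATIM from the skeleton of
record `extraction_line.lean` (sha16 c94d95e4bac10446), the split `StubOmegaLimit ⇐ StubFrameSup ∧ StubFrameLip ∧ StubClosure`,
(E1a) `stubFrameSup_holds`, and the derivative of the frames with the Lipschitz constant `lipK`.
-/

noncomputable section

set_option linter.dupNamespace false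

namespace Summit.NavierStokesRegularity.NavierStokesRegularity.Cruxes.MinimalBlowupExtraction.ClockedFrames

open Set Filter Topology MeasureTheory
open scoped RealInnerProductSpace
open Literature.Analysis.FluidPDE Literature.Analysis.FluidPDE.TaoCascade
open Summit.NavierStokesRegularity.NavierStokesRegularity.Cruxes.MinimalBlowupExtraction.Extraction
  (exists_subseq_continuousLimit_param)
open Summit.NavierStokesRegularity.NavierStokesRegularity.Theorems.DSSOneShift
  (hasDerivWithinAt_shellVec bigLam_zpow_eq_rpow)
open Summit.NavierStokesRegularity.NavierStokesRegularity.Theorems.WakeRatchetCritical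
  (tableQ_smul tableA_smul tableB_smul_smul continuous_tableB)
open Summit.NavierStokesRegularity.NavierStokesRegularity.Theorems.TransitMassLedgerEnergy
  (continuous_tableQ continuous_tableA continuous_tableB_comp)
open Summit.NavierStokesRegularity.NavierStokesRegularity.Cruxes.MinimalBlowupExtraction.TableCont

/-! ## The objects -/

/-- The hypothesis bundle of ⟨22744⟩, verbatim: an exact `ν`-viscous lattice solution `X` on `[0,T)` from the
one-shell datum `X₀` at shell 0, CRITICALLY PINNED (type-I, uniform per-shell action, two-sided pinning at
a = 1 with every shell `n ≥ 0` firing). -/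
def Pinned (ε₀ : ℝ) (α : Fin 4 → Fin 4 → Fin 4 → ℤ × ℤ × ℤ → ℝ) (X₀ : Fin 4 → ℝ) (ν T C c : ℝ)
    (X : Fin 4 → ℤ → ℝ → ℝ) : Prop :=
  0 < ν ∧ 0 < T ∧ 0 < c ∧ (∀ i n, ContDiffOn ℝ 1 (X i n) (Set.Ico 0 T)) ∧
    (∀ i n, X i n 0 = if n = 0 then X₀ i else 0) ∧ (∀ i n t, n < 0 → X i n t = 0) ∧
    (∀ i n t, 0 ≤ t → t < T → derivWithin (X i n) (Set.Ici 0) t =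
      quadTerm ε₀ α X i n t - ν * (1 + ε₀) ^ ((2 : ℝ) * n) * X i n t) ∧
    (∀ (n : ℤ) (t : ℝ), 0 ≤ t → t < T → bigLam ε₀ ^ n * (T - t) * ‖shellVec X n t‖ ≤ C) ∧
    (∀ n : ℤ, IntegrableOn (fun t => ‖shellVec X n t‖) (Set.Ico 0 T) ∧
      bigLam ε₀ ^ n * (∫ t in Set.Ico 0 T, ‖shellVec X n t‖) ≤ C) ∧
    (∀ (n : ℤ) (t : ℝ), 0 ≤ t → t < T → (1 + ε₀) ^ n * ‖shellVec X n t‖ ^ 2 ≤ C) ∧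
    (∀ n : ℤ, 0 ≤ n → ∃ t : ℝ, 0 ≤ t ∧ t < T ∧ c ≤ (1 + ε₀) ^ n * ‖shellVec X n t‖ ^ 2)

/-- CLOCKED FIRING: re-selected firing times `τ m ∈ [0,T)` of the shells `m ≥ 0` with the TWO-SIDED
self-similar clock `κ₁ (1+ε₀)^{-2m} ≤ T − τ m ≤ κ₂ (1+ε₀)^{-2m}` and the amplitude floor `p_m(τ m) ≥ c'`. -/
def ClockedFiring (ε₀ T c' κ₁ κ₂ : ℝ) (X : Fin 4 → ℤ → ℝ → ℝ) (τ : ℕ → ℝ) : Prop :=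
  ∀ m : ℕ, 0 ≤ τ m ∧ τ m < T ∧
    κ₁ * ((1 + ε₀) ^ (2 * m))⁻¹ ≤ T - τ m ∧ T - τ m ≤ κ₂ * ((1 + ε₀) ^ (2 * m))⁻¹ ∧
    c' ≤ (1 + ε₀) ^ m * ‖shellVec X (m : ℤ) (τ m)‖ ^ 2

/-- The self-similar renormalisation around the blow-up time: `W̃_n(σ) = Λ^n e^{-σ} X_n(T − e^{-σ})`. -/
def renorm (ε₀ T : ℝ) (X : Fin 4 → ℤ → ℝ → ℝ) : ℤ → ℝ → Em 4 :=
  fun n σ => (bigLam ε₀ ^ n * Real.exp (-σ)) • shellVec X n (T - Real.exp (-σ))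

/-- The FRAME centred at shell `m` and log-time `s`: `frame_n(σ) = W̃_{n+m}(σ + s)`. -/
def frame (ε₀ T : ℝ) (X : Fin 4 → ℤ → ℝ → ℝ) (m : ℕ) (s : ℝ) : ℤ → ℝ → Em 4 :=
  fun n σ => renorm ε₀ T X (n + m) (σ + s)

/-- CONTINUOUS CONVERGENCE of the clock-centred frames along `φ` to `W` (Arzelà–Ascoli output form). -/
def FramesConverge (ε₀ T : ℝ) (X : Fin 4 → ℤ → ℝ → ℝ) (τ : ℕ → ℝ) (φ : ℕ → ℕ)
    (W : ℤ → ℝ → Em 4) : Prop :=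
  ∀ (n : ℤ) (u : ℕ → ℝ) (σ : ℝ), Tendsto u atTop (𝓝 σ) →
    Tendsto (fun j => frame ε₀ T X (φ j) (-Real.log (T - τ (φ j))) n (u j)) atTop (𝓝 (W n σ))

/-! ## The registered obligation Props (verbatim) -/

/-- STUB 1 (M): THE TWO-SIDED FIRING CLOCK.  Upper clock from type-I + the amplitude floor; lower clock from
the Lipschitz bound `|ṗ_m| ≤ K(1+ε₀)^{2m}` (cancellation identity + bond-flux bound + UPPER pinning) and the
one-shell datum (`p_m(0) = 0`, `m ≥ 1`). -/
def StubClock : Prop :=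
  ∀ (ε₀ R : ℝ) (α : Fin 4 → Fin 4 → Fin 4 → ℤ × ℤ × ℤ → ℝ) (X₀ : Fin 4 → ℝ) (ν T C c : ℝ)
    (X : Fin 4 → ℤ → ℝ → ℝ), 0 < ε₀ → InTableClass R α → Pinned ε₀ α X₀ ν T C c X →
    ∃ c' κ₁ κ₂ : ℝ, 0 < c' ∧ 0 < κ₁ ∧ 0 < κ₂ ∧ ∃ τ : ℕ → ℝ, ClockedFiring ε₀ T c' κ₁ κ₂ X τ

/-- STUB 2 (L, load-bearing): THE CLOCKED ω-LIMIT.  Frames centred at the clocked firings have viscosity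
parameters in `[νκ₁, νκ₂]`, sup-norm `≤ C`, per-shell action `≤ C`, `e^{2σ}‖·‖²`-envelopes uniform in the
frame; Arzelà–Ascoli + diagonal + ODE closure + Fatou produce an admissible uniformly bounded viscous
eternal limit with continuous convergence of the frames. -/
def StubOmegaLimit : Prop :=
  ∀ (ε₀ R : ℝ) (α : Fin 4 → Fin 4 → Fin 4 → ℤ × ℤ × ℤ → ℝ) (X₀ : Fin 4 → ℝ) (ν T C c : ℝ)
    (X : Fin 4 → ℤ → ℝ → ℝ), 0 < ε₀ → InTableClass R α → Pinned ε₀ α X₀ ν T C c X →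
    ∀ (c' κ₁ κ₂ : ℝ) (τ : ℕ → ℝ), 0 < κ₁ → ClockedFiring ε₀ T c' κ₁ κ₂ X τ →
      ∃ (νh : ℝ) (W : ℤ → ℝ → Em 4) (φ : ℕ → ℕ), StrictMono φ ∧
        IsEternalVisc ε₀ νh α W ∧ UniformBound W ∧ FramesConverge ε₀ T X τ φ W

/-- STUB 3 (M): SURVIVAL PASSES TO THE LIMIT.  In the frame centred at shell `m`, frame-shell `n` fires in the
log-time window `2n·log(1+ε₀) ± log(κ₂/κ₁)` with weighted energy `≥ c'κ₁²`, uniformly in the frame;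
continuous convergence transports the floor to the limit. -/
def StubSurvival : Prop :=
  ∀ (ε₀ T c' κ₁ κ₂ : ℝ) (X : Fin 4 → ℤ → ℝ → ℝ) (τ : ℕ → ℝ) (φ : ℕ → ℕ) (W : ℤ → ℝ → Em 4),
    0 < ε₀ → 0 < T → 0 < c' → 0 < κ₁ → 0 < κ₂ → ClockedFiring ε₀ T c' κ₁ κ₂ X τ → StrictMono φ →
    FramesConverge ε₀ T X τ φ W → EternalSurvivingFwd 1 ε₀ W

/-! ## The split of `StubOmegaLimit` -/

variable {ε₀ : ℝ} {α : Fin 4 → Fin 4 → Fin 4 → ℤ × ℤ × ℤ → ℝ} {X₀ : Fin 4 → ℝ} {ν T C c : ℝ}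
  {X : Fin 4 → ℤ → ℝ → ℝ} {c' κ₁ κ₂ : ℝ} {τ : ℕ → ℝ}

/-- The renormalised viscosity parameter of the frame centred at shell `m`: `ν (1+ε₀)^{2m} (T − τ_m)`. -/
def viscParam (ε₀ ν T : ℝ) (τ : ℕ → ℝ) (m : ℕ) : ℝ := ν * ((1 + ε₀) ^ (2 * m) * (T - τ m))

/-- (E1a) The clocked frames are EVENTUALLY uniformly bounded on every half-line, shell by shell. -/
def StubFrameSup : Prop :=
  ∀ (ε₀ R : ℝ) (α : Fin 4 → Fin 4 → Fin 4 → ℤ × ℤ × ℤ → ℝ) (X₀ : Fin 4 → ℝ) (ν T C c : ℝ)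
    (X : Fin 4 → ℤ → ℝ → ℝ), 0 < ε₀ → InTableClass R α → Pinned ε₀ α X₀ ν T C c X →
    ∀ (c' κ₁ κ₂ : ℝ) (τ : ℕ → ℝ), 0 < κ₁ → ClockedFiring ε₀ T c' κ₁ κ₂ X τ →
      ∀ (n : ℤ) (a : ℝ), ∃ C₁ : ℝ, ∃ J : ℕ, ∀ j, J ≤ j → ∀ u : ℝ, a ≤ u →
        ‖frame ε₀ T X j (-Real.log (T - τ j)) n u‖ ≤ C₁

/-- (E1b) The clocked frames are EVENTUALLY equi-Lipschitz on every half-line, shell by shell. -/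
def StubFrameLip : Prop :=
  ∀ (ε₀ R : ℝ) (α : Fin 4 → Fin 4 → Fin 4 → ℤ × ℤ × ℤ → ℝ) (X₀ : Fin 4 → ℝ) (ν T C c : ℝ)
    (X : Fin 4 → ℤ → ℝ → ℝ), 0 < ε₀ → InTableClass R α → Pinned ε₀ α X₀ ν T C c X →
    ∀ (c' κ₁ κ₂ : ℝ) (τ : ℕ → ℝ), 0 < κ₁ → ClockedFiring ε₀ T c' κ₁ κ₂ X τ →
      ∀ (n : ℤ) (a : ℝ), ∃ K : ℝ, ∃ J : ℕ, ∀ j, J ≤ j → ∀ u v : ℝ, a ≤ u → a ≤ v →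
        ‖frame ε₀ T X j (-Real.log (T - τ j)) n u - frame ε₀ T X j (-Real.log (T - τ j)) n v‖ ≤ K * |u - v|

/-- (E3) CLOSURE: a continuous limit of the clocked frames whose viscosity parameters converge is an admissible
viscous eternal solution, uniformly bounded. -/
def StubClosure : Prop :=
  ∀ (ε₀ R : ℝ) (α : Fin 4 → Fin 4 → Fin 4 → ℤ × ℤ × ℤ → ℝ) (X₀ : Fin 4 → ℝ) (ν T C c : ℝ)
    (X : Fin 4 → ℤ → ℝ → ℝ), 0 < ε₀ → InTableClass R α → Pinned ε₀ α X₀ ν T C c X →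
    ∀ (c' κ₁ κ₂ : ℝ) (τ : ℕ → ℝ), 0 < κ₁ → ClockedFiring ε₀ T c' κ₁ κ₂ X τ →
      ∀ (φ : ℕ → ℕ) (W : ℤ → ℝ → Em 4) (νh : ℝ), StrictMono φ → νh ∈ Icc (ν * κ₁) (ν * κ₂) →
        Tendsto (fun j => viscParam ε₀ ν T τ (φ j)) atTop (𝓝 νh) → FramesConverge ε₀ T X τ φ W →
        IsEternalVisc ε₀ νh α W ∧ UniformBound W

/-- The viscosity parameters of the clocked frames lie in the band `[νκ₁, νκ₂]`. -/
theorem viscParam_mem (hν : 0 < ν) (hε : 0 < ε₀) (hclk : ClockedFiring ε₀ T c' κ₁ κ₂ X τ) (m : ℕ) :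
    viscParam ε₀ ν T τ m ∈ Icc (ν * κ₁) (ν * κ₂) := by
  have hb : (0 : ℝ) < 1 + ε₀ := by linarith
  obtain ⟨-, -, hlow, hup, -⟩ := hclk m
  have hP : 0 < (1 + ε₀) ^ (2 * m) := pow_pos hb _
  have h1 : κ₁ ≤ (1 + ε₀) ^ (2 * m) * (T - τ m) := by
    rw [mul_comm, ← mul_inv_le_iff₀ hP]; exact hlow
  have h2 : (1 + ε₀) ^ (2 * m) * (T - τ m) ≤ κ₂ := by
    rw [mul_comm, ← le_mul_inv_iff₀ hP]
    exact hup
  exact ⟨mul_le_mul_of_nonneg_left h1 hν.le, mul_le_mul_of_nonneg_left h2 hν.le⟩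

/-- **The split**: frame bounds + closure give the registered `StubOmegaLimit`, the extraction being the abstract
lemma. -/
theorem stubOmegaLimit_of (h₁ : StubFrameSup) (h₂ : StubFrameLip) (h₃ : StubClosure) : StubOmegaLimit := by
  intro ε₀ R α X₀ ν T C c X hε hα hP c' κ₁ κ₂ τ hκ₁ hclk
  have hν : 0 < ν := hP.1
  obtain ⟨φ, hφ, ⟨νh, hνh, hlimν⟩, W, hW⟩ := exists_subseq_continuousLimit_param
    (fun j => frame ε₀ T X j (-Real.log (T - τ j))) (h₁ ε₀ R α X₀ ν T C c X hε hα hP c' κ₁ κ₂ τ hκ₁ hclk)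
    (h₂ ε₀ R α X₀ ν T C c X hε hα hP c' κ₁ κ₂ τ hκ₁ hclk) (viscParam ε₀ ν T τ) (ν * κ₁) (ν * κ₂)
    (viscParam_mem hν hε hclk)
  have hconv : FramesConverge ε₀ T X τ φ W := fun n u σ hu => hW n u σ hu
  obtain ⟨hEV, hUB⟩ := h₃ ε₀ R α X₀ ν T C c X hε hα hP c' κ₁ κ₂ τ hκ₁ hclk φ W νh hφ hνh hlimν hconv
  exact ⟨νh, W, φ, hφ, hEV, hUB, hconv⟩

/-! ## (E1a) proved: the frames are eventually bounded by the type-I constant -/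

/-- `exp(−(u − log g)) = exp(−u)·g` for `g > 0`. -/
theorem exp_shift {u g : ℝ} (hg : 0 < g) : Real.exp (-(u + -Real.log g)) = Real.exp (-u) * g := by
  rw [show -(u + -Real.log g) = -u + Real.log g by ring, Real.exp_add, Real.exp_log hg]

/-- The clock makes the frames' log-time origins recede: eventually `e^{-a} (T − τ_j) ≤ T`. -/
theorem eventually_window (hε : 0 < ε₀) (hT : 0 < T) (hclk : ClockedFiring ε₀ T c' κ₁ κ₂ X τ) (a : ℝ) :
    ∃ J : ℕ, ∀ j, J ≤ j → Real.exp (-a) * (T - τ j) < T := by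
  have hb1 : (1 : ℝ) < (1 + ε₀) ^ 2 := by nlinarith
  have ht : Tendsto (fun j : ℕ => Real.exp (-a) * κ₂ * ((1 + ε₀) ^ (2 * j))⁻¹) atTop (𝓝 0) := by
    have h1 : Tendsto (fun j : ℕ => ((1 + ε₀) ^ 2) ^ j) atTop atTop := tendsto_pow_atTop_atTop_of_one_lt hb1
    have h2 : Tendsto (fun j : ℕ => (((1 + ε₀) ^ 2) ^ j)⁻¹) atTop (𝓝 0) := tendsto_inv_atTop_zero.comp h1
    have h3 := h2.const_mul (Real.exp (-a) * κ₂)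
    rw [mul_zero] at h3
    refine h3.congr fun j => ?_
    rw [pow_mul]
  obtain ⟨J, hJ⟩ := (ht.eventually (gt_mem_nhds hT)).exists_forall_of_atTop
  refine ⟨J, fun j hj => lt_of_le_of_lt ?_ (hJ j hj)⟩
  obtain ⟨-, -, -, hup, -⟩ := hclk j
  have := mul_le_mul_of_nonneg_left hup (Real.exp_pos (-a)).le
  linarith

/-- **(E1a) PROVED.** -/
theorem stubFrameSup_holds : StubFrameSup := by
  intro ε₀ R α X₀ ν T C c X hε _hα hP c' κ₁ κ₂ τ _hκ₁ hclk n a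
  obtain ⟨hν, hT, hc, hcd, hX0, hneg, hlaw, htypeI, hint, hpin, hfire⟩ := hP
  obtain ⟨J, hJ⟩ := eventually_window hε hT hclk a
  refine ⟨C, J, fun j hj u hu => ?_⟩
  have gj : 0 < T - τ j := by linarith [(hclk j).2.1]
  have he : Real.exp (-(u + -Real.log (T - τ j))) = Real.exp (-u) * (T - τ j) := exp_shift gj
  have hepos : 0 < Real.exp (-u) * (T - τ j) := mul_pos (Real.exp_pos _) gj
  have heT : Real.exp (-u) * (T - τ j) < T := by
    have h1 : Real.exp (-u) ≤ Real.exp (-a) := Real.exp_le_exp.2 (by linarith)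
    have h2 := mul_le_mul_of_nonneg_right h1 gj.le
    linarith [hJ j hj]
  have hL : 0 < bigLam ε₀ ^ (n + (j : ℤ)) := zpow_pos (bigLam_pos (by linarith)) _
  simp only [frame, renorm]
  rw [he, norm_smul, Real.norm_of_nonneg (mul_pos hL hepos).le]
  have hI := htypeI (n + (j : ℤ)) (T - Real.exp (-u) * (T - τ j)) (by linarith) (by linarith)
  rw [sub_sub_cancel] at hI
  exact hI

/-! ## (E1b) proved: the frames are eventually equi-Lipschitz on half-lines -/

/-- The velocity vector of shell `n` at time `t`: `Ẋ_n = (quadTerm_{·,n}) − ν(1+ε₀)^{2n} X_n`. -/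
def dvec (ε₀ : ℝ) (α : Fin 4 → Fin 4 → Fin 4 → ℤ × ℤ × ℤ → ℝ) (ν : ℝ) (X : Fin 4 → ℤ → ℝ → ℝ)
    (n : ℤ) (t : ℝ) : Em 4 :=
  shellVec (fun i k s => quadTerm ε₀ α X i k s) n t - (ν * (1 + ε₀) ^ ((2 : ℝ) * n)) • shellVec X n t

/-- The norm of the nonlinearity vector of shell `n` by the table bounds. -/
theorem norm_qvec_le (hε : 0 < ε₀) (n : ℤ) (t : ℝ) :
    ‖shellVec (fun i k s => quadTerm ε₀ α X i k s) n t‖ ≤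
      bigLam ε₀ ^ n * (shiftConst α (0, 0, 0) * ‖shellVec X n t‖ ^ 2 +
        (shiftConst α (1, 0, 0) + shiftConst α (0, 1, 0)) * ‖shellVec X (n + 1) t‖ * ‖shellVec X n t‖) +
      bigLam ε₀ ^ (n - 1) * (shiftConst α (0, 0, 1) * ‖shellVec X (n - 1) t‖ ^ 2) := by
  have hb : 0 < 1 + ε₀ := by linarith
  have hL : ∀ k : ℤ, 0 < bigLam ε₀ ^ k := fun k => zpow_pos (bigLam_pos (by linarith)) k
  have e1 : (1 + ε₀) ^ ((5 : ℝ) * n / 2) = bigLam ε₀ ^ n := bigLam_zpow_eq_rpow hb n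
  have e2 : (1 + ε₀) ^ ((5 : ℝ) * ((n : ℝ) - 1) / 2) = bigLam ε₀ ^ (n - 1) := by
    have h := bigLam_zpow_eq_rpow hb (n - 1)
    push_cast at h
    exact h
  rw [shellVec_quadTerm, e1, e2]
  have hQ := norm_tableQ_le α (shellVec X n t)
  have hB := norm_tableB_le α (shellVec X (n + 1) t) (shellVec X n t)
  have hA := norm_tableA_le α (shellVec X (n - 1) t)
  calc ‖bigLam ε₀ ^ n • tableQ α (shellVec X n t) +
          bigLam ε₀ ^ n • tableB α (shellVec X (n + 1) t) (shellVec X n t) +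
          bigLam ε₀ ^ (n - 1) • tableA α (shellVec X (n - 1) t)‖
      ≤ ‖bigLam ε₀ ^ n • tableQ α (shellVec X n t)‖ +
          ‖bigLam ε₀ ^ n • tableB α (shellVec X (n + 1) t) (shellVec X n t)‖ +
          ‖bigLam ε₀ ^ (n - 1) • tableA α (shellVec X (n - 1) t)‖ := norm_add₃_le
    _ = bigLam ε₀ ^ n * ‖tableQ α (shellVec X n t)‖ +
          bigLam ε₀ ^ n * ‖tableB α (shellVec X (n + 1) t) (shellVec X n t)‖ +
          bigLam ε₀ ^ (n - 1) * ‖tableA α (shellVec X (n - 1) t)‖ := by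
        rw [norm_smul, norm_smul, norm_smul, Real.norm_of_nonneg (hL n).le,
          Real.norm_of_nonneg (hL (n - 1)).le]
    _ ≤ bigLam ε₀ ^ n * (shiftConst α (0, 0, 0) * ‖shellVec X n t‖ ^ 2) +
          bigLam ε₀ ^ n * ((shiftConst α (1, 0, 0) + shiftConst α (0, 1, 0)) *
            ‖shellVec X (n + 1) t‖ * ‖shellVec X n t‖) +
          bigLam ε₀ ^ (n - 1) * (shiftConst α (0, 0, 1) * ‖shellVec X (n - 1) t‖ ^ 2) :=
        add_le_add_three (mul_le_mul_of_nonneg_left hQ (hL n).le)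
          (mul_le_mul_of_nonneg_left hB (hL n).le) (mul_le_mul_of_nonneg_left hA (hL (n - 1)).le)
    _ = _ := by ring

/-- Interior derivative of a component: on `(0,T)` the one-sided law is a two-sided derivative. -/
theorem hasDerivAt_comp (hP : Pinned ε₀ α X₀ ν T C c X) (i : Fin 4) (k : ℤ) {t : ℝ} (ht : t ∈ Ioo 0 T) :
    HasDerivAt (X i k) (quadTerm ε₀ α X i k t - ν * (1 + ε₀) ^ ((2 : ℝ) * k) * X i k t) t := by
  obtain ⟨-, -, -, hcd, -, -, hlaw, -⟩ := hP
  have hIco : Ico 0 T ∈ 𝓝 t := mem_of_superset (isOpen_Ioo.mem_nhds ht) Ioo_subset_Ico_self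
  have hd : DifferentiableAt ℝ (X i k) t :=
    ((hcd i k).differentiableOn one_ne_zero t (Ioo_subset_Ico_self ht)).differentiableAt hIco
  have h1 := hd.hasDerivAt
  have h2 : deriv (X i k) t = derivWithin (X i k) (Ici 0) t :=
    (derivWithin_of_mem_nhds (Ici_mem_nhds ht.1)).symm
  rw [h2, hlaw i k t ht.1.le ht.2] at h1
  exact h1

/-- Interior derivative of a shell vector. -/
theorem hasDerivAt_shell (hP : Pinned ε₀ α X₀ ν T C c X) (k : ℤ) {t : ℝ} (ht : t ∈ Ioo 0 T) :
    HasDerivAt (shellVec X k) (dvec ε₀ α ν X k t) t := by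
  have hv : HasDerivWithinAt (shellVec X k)
      (WithLp.toLp 2 fun i => quadTerm ε₀ α X i k t - ν * (1 + ε₀) ^ ((2 : ℝ) * k) * X i k t) univ t :=
    Summit.NavierStokesRegularity.NavierStokesRegularity.Theorems.DSSOneShift.hasDerivWithinAt_shellVec
      fun i => (hasDerivAt_comp hP i k ht).hasDerivWithinAt
  have heq : (WithLp.toLp 2 fun i => quadTerm ε₀ α X i k t - ν * (1 + ε₀) ^ ((2 : ℝ) * k) * X i k t :
      Em 4) = dvec ε₀ α ν X k t := by
    ext i
    simp [dvec, shellVec, smul_eq_mul]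
  rw [heq] at hv
  exact hasDerivWithinAt_univ.1 hv

/-- The derivative of a frame in its log-time (chain rule through `t = T − e^{-(u+s)}`). -/
theorem hasDerivAt_frame (hP : Pinned ε₀ α X₀ ν T C c X) (j : ℕ) (n : ℤ) (s : ℝ) {u : ℝ}
    (hwin : Real.exp (-(u + s)) < T) :
    HasDerivAt (fun v => frame ε₀ T X j s n v)
      ((bigLam ε₀ ^ (n + (j : ℤ)) * Real.exp (-(u + s))) •
          (Real.exp (-(u + s)) • dvec ε₀ α ν X (n + (j : ℤ)) (T - Real.exp (-(u + s)))) +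
        (bigLam ε₀ ^ (n + (j : ℤ)) * -Real.exp (-(u + s))) •
          shellVec X (n + (j : ℤ)) (T - Real.exp (-(u + s)))) u := by
  have ht : T - Real.exp (-(u + s)) ∈ Ioo 0 T :=
    ⟨by linarith, by linarith [Real.exp_pos (-(u + s))]⟩
  have hin : HasDerivAt (fun v => -(v + s)) (-1) u := ((hasDerivAt_id u).add_const s).neg
  have hE : HasDerivAt (fun v => Real.exp (-(v + s))) (-Real.exp (-(u + s))) u := by
    have h := (Real.hasDerivAt_exp (-(u + s))).comp u hin
    have e : Real.exp (-(u + s)) * -1 = -Real.exp (-(u + s)) := by ring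
    rw [e] at h
    exact h
  have hθ : HasDerivAt (fun v => T - Real.exp (-(v + s))) (Real.exp (-(u + s))) u := by
    have h := hE.const_sub T
    rw [neg_neg] at h
    exact h
  have hS : HasDerivAt (fun v => shellVec X (n + (j : ℤ)) (T - Real.exp (-(v + s))))
      (Real.exp (-(u + s)) • dvec ε₀ α ν X (n + (j : ℤ)) (T - Real.exp (-(u + s)))) u := by
    have h := (hasDerivAt_shell hP (n + (j : ℤ)) ht).scomp u hθ
    simpa only [Function.comp_def] using h
  have hc : HasDerivAt (fun v => bigLam ε₀ ^ (n + (j : ℤ)) * Real.exp (-(v + s)))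
      (bigLam ε₀ ^ (n + (j : ℤ)) * -Real.exp (-(u + s))) u := hE.const_mul _
  exact hc.smul hS

/-- The equi-Lipschitz constant of the frames on the half-line `[a, ∞)` at frame-shell `n`. -/
def lipK (α : Fin 4 → Fin 4 → Fin 4 → ℤ × ℤ × ℤ → ℝ) (ν C ε₀ κ₂ : ℝ) (n : ℤ) (a : ℝ) : ℝ :=
  C + (shiftConst α (0, 0, 0) * C ^ 2 +
      (shiftConst α (1, 0, 0) + shiftConst α (0, 1, 0)) * C ^ 2 * (bigLam ε₀)⁻¹ +
      shiftConst α (0, 0, 1) * bigLam ε₀ * C ^ 2) +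
    ν * κ₂ * Real.exp (-a) * (1 + ε₀) ^ ((2 : ℝ) * n) * C

end Summit.NavierStokesRegularity.NavierStokesRegularity.Cruxes.MinimalBlowupExtraction.ClockedFrames

end
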